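import Literature.ModelTheory.ExponentialFields.ExponentialField
import HarnessLib

/-!
# Surjectivity of the exponential (`IsSurjectiveOntoUnits`): an axiom, not a theorem

`Literature.ExponentialRing.IsSurjectiveOntoUnits R` (file `ExponentialField.lean`) vendors the condition
"every non-zero element of `R` is an exponential", i.e. `∀ y ≠ 0, ∃ x, exp x = y`. In the literature
this is an **axiom** singled out among exponential fields, never a theorem about all of them:

* Zilber 2005, §1: the basic class `𝓔` consists of algebraically closed fields `F` of
  characteristic zero with `ex : (F, +) → (F*, ·)` a *surjective* homomorphism (as restated in
  D'Aquino–Macintyre–Terzo 2010 §2 and Bays–Kirby 2013 §2.1, axiom 1);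
* Kirby, *A note on the axioms for Zilber's pseudo-exponential fields* (2013), §2, axiom 1
  ("ELA-field: … its exponential map is a homomorphism from its additive group to its
  multiplicative group, which is surjective");
* Kirby, *Finitely presented exponential fields* (2013), Definition 2.10: "An EL-field is a (total)
  exponential field in which every non-zero element has a logarithm" — literally the vendored
  predicate.

Consequently the Lean declaration is a *predicate* on exponential rings (its ring argument `R` is
explicit; it is consumed as a hypothesis `(hsurj : IsSurjectiveOntoUnits K)` by the Zilber-field
files), and there is **no** unconditional `IsSurjectiveOntoUnits_holds`: the universal closure is
false. This file records that precisely and adds the unfolding lemmas justifying the name.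

Contents (all in `namespace Literature.ExponentialRing`):

* `isSurjectiveOntoUnits_iff_forall_units`: over a division ring, `IsSurjectiveOntoUnits K` says
  exactly that every unit `u : Kˣ` is an exponential (surjectivity of `exp : K → Kˣ`).
* `isSurjectiveOntoUnits_iff_range_exp`: equivalently `Set.range exp = {0}ᶜ`.
* `not_isSurjectiveOntoUnits_of_exp_eq_one`: the trivial exponential `exp = 1` is not surjective as
  soon as the ring has an element other than `0` and `1`; `exists_exponentialRing_not_isSurjectiveOntoUnits`
  packages the instance `(ℚ, exp = 1)`.
* `not_isSurjectiveOntoUnits_real`: the real exponential field `ℝ_exp` fails it (`Real.exp x > 0`, so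
  `-1` is not an exponential), although `ℂ_exp` satisfies it (`isSurjectiveOntoUnits_complex` in
  `ExponentialField.lean`).
* `not_forall_isSurjectiveOntoUnits`: hence the would-be fact
  `∀ R [Field R] [CharZero R] [ExponentialRing R], IsSurjectiveOntoUnits R` is refutable (witness `ℝ`).

## References

* B. Zilber, *Pseudo-exponentiation on algebraically closed fields of characteristic zero*,
  Ann. Pure Appl. Logic 132 (2005) 67–95, §1.
* J. Kirby, *A note on the axioms for Zilber's pseudo-exponential fields*, Notre Dame J. Formal
  Logic 54 (2013) 509–520, §2.
* J. Kirby, *Finitely presented exponential fields*, Algebra & Number Theory 7 (2013) 943–980,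
  Definition 2.10.
* M. Bays, J. Kirby, *Excellence and uncountable categoricity of Zilber's exponential fields*
  arXiv:1305.0493 (2013), §2.1.
* P. D'Aquino, A. Macintyre, G. Terzo, *Schanuel Nullstellensatz for Zilber fields*,
  Fund. Math. 207 (2010), §2.
-/

noncomputable section

namespace Literature.ModelTheory.ExponentialFields

namespace ExponentialRing

section DivisionRing

variable {K : Type*} [DivisionRing K] [ExponentialRing K]

/-- Over a division ring, `IsSurjectiveOntoUnits K` says precisely that the exponential is
surjective onto the multiplicative group: every unit `u : Kˣ` is of the form `exp x`
(Kirby 2013, Def. 2.10: "every non-zero element has a logarithm"; Zilber 2005 §1: `ex : (F, +) →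
(F*, ·)` is surjective; Kirby 2013 (note on the axioms) §2, axiom 1 "ELA-field").
[cite: Kirby2013, Definition 2.10] [cite: Kirby2013Axioms, §2 axiom 1] -/
theorem isSurjectiveOntoUnits_iff_forall_units :
    IsSurjectiveOntoUnits K ↔ ∀ u : Kˣ, ∃ x : K, exp x = u := by
  constructor
  · intro h u
    exact h u u.ne_zero
  · intro h y hy
    obtain ⟨x, hx⟩ := h (Units.mk0 y hy)
    exact ⟨x, by rw [hx, Units.val_mk0]⟩

/-- Over a division ring, `IsSurjectiveOntoUnits K` holds iff the image of `exp` is exactly the set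
of non-zero elements (`exp x` is always a unit, `ExponentialRing.isUnit_exp`). [folklore] -/
theorem isSurjectiveOntoUnits_iff_range_exp :
    IsSurjectiveOntoUnits K ↔ Set.range (exp : K → K) = {0}ᶜ := by
  constructor
  · intro h
    ext y
    simp only [Set.mem_range, Set.mem_compl_iff, Set.mem_singleton_iff]
    constructor
    · rintro ⟨x, rfl⟩
      exact (isUnit_exp x).ne_zero
    · intro hy
      exact h y hy
  · intro h y hy
    have hy' : y ∈ Set.range (exp : K → K) := by
      rw [h, Set.mem_compl_iff, Set.mem_singleton_iff]
      exact hy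
    exact hy'

end DivisionRing

section Trivial

variable {R : Type*} [Ring R] [ExponentialRing R]

/-- The trivial exponential `exp = 1` (an exponential ring in the sense of van den Dries 1984) is not
surjective onto the non-zero elements as soon as the ring has an element `y ∉ {0, 1}`: such a `y` is
not an exponential. In particular surjectivity is a genuine axiom on exponential fields
(Kirby 2013 Def. 2.10, "EL-field"), not a consequence of the E-ring axioms. [folklore] -/
theorem not_isSurjectiveOntoUnits_of_exp_eq_one (h : ∀ x : R, exp x = 1) {y : R} (hy0 : y ≠ 0)
    (hy1 : y ≠ 1) : ¬ IsSurjectiveOntoUnits R := by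
  intro hs
  obtain ⟨x, hx⟩ := hs y hy0
  exact hy1 (hx.symm.trans (h x))

/-- `ℚ` with the trivial exponential `exp = 1` is an exponential field of characteristic zero whose
exponential is not surjective onto `ℚˣ` (`2` is not an exponential). [folklore] -/
theorem exists_exponentialRing_not_isSurjectiveOntoUnits :
    ∃ E : ExponentialRing ℚ, ¬ @IsSurjectiveOntoUnits ℚ _ E :=
  ⟨⟨fun _ => 1, rfl, fun _ _ => (one_mul 1).symm⟩,
    @not_isSurjectiveOntoUnits_of_exp_eq_one ℚ _ ⟨fun _ => 1, rfl, fun _ _ => (one_mul 1).symm⟩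
      (fun _ => rfl) 2 two_ne_zero (by norm_num)⟩

end Trivial

/-- The real exponential field `ℝ_exp` does **not** have surjective exponential: `Real.exp x > 0`
for all `x` (Mathlib `Real.exp_pos`), so `-1 ∈ ℝˣ` is not an exponential. (Contrast
`isSurjectiveOntoUnits_complex`: `ℂ_exp` is an EL-field, Kirby 2013 Def. 2.10.) [folklore] -/
theorem not_isSurjectiveOntoUnits_real : ¬ IsSurjectiveOntoUnits ℝ := by
  intro h
  obtain ⟨x, hx⟩ := h (-1) (by norm_num)
  have hpos : (0 : ℝ) < Real.exp x := Real.exp_pos x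
  have hx' : Real.exp x = -1 := hx
  linarith

/-- There is no unconditional `IsSurjectiveOntoUnits_holds`: surjectivity of the exponential is an
axiom of Zilber's pseudo-exponential fields / EL(A)-fields (Zilber 2005 §1; Kirby 2013 Def. 2.10;
Bays–Kirby 2013 §2.1 axiom 1),
and it already fails for the exponential field `ℝ_exp` of characteristic zero
(`not_isSurjectiveOntoUnits_real`). Users keep `(h : IsSurjectiveOntoUnits K)` as a hypothesis. [folklore] -/
theorem not_forall_isSurjectiveOntoUnits :
    ¬ ∀ (R : Type) [Field R] [CharZero R] [ExponentialRing R], IsSurjectiveOntoUnits R :=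
  fun h => not_isSurjectiveOntoUnits_real (h ℝ)

end ExponentialRing

end Literature.ModelTheory.ExponentialFields
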